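import Mathlib
import HarnessLib
import Summits.Ventures.LatticeQCDFlow.Scaling.AutoregressiveContextExact
import Summits.Ventures.LatticeQCDFlow.Scaling.EliminationFrontTorus

/-!
# LatticeQCDFlow / Scaling — counting the exact context: some site reads at least `treewidth` sites in
# every order, `≥ c_d·L^{d−1}` on the torus, the minimax over orders is exactly the treewidth; the
# ISING instance

HONEST FRAMING: exact (Metropolis-corrected) sampling algorithms for lattice gauge theory;
figures of merit are autocorrelation/cost numbers at stated couplings and volumes; no
continuum-physics claim.

Venture `LatticeQCDFlow` (cell pub-lqcd), topic `Scaling`, FANOUT row 30 (lean-1, GEN-17) — OUR WORK,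
sequel of `Scaling/AutoregressiveContextExact` (for a strictly TP₂ ferromagnetic pair interaction on a
graph `G` the exact autoregressive conditional of `a` reads `v ≠ a` iff `v ∈ adj⁺_{elim G}(a)`; the read
set IS the higher fill-neighbourhood) combined with GEN-14's elimination-graph combinatorics
(`Literature/Combinatorics/SimpleGraph/EliminationGraph`, `Scaling/EliminationFrontTorus`):

* **`pairBondWeight_exists_readSet_ge_treewidth`** — in EVERY linear order some site reads exactly
  `elimWidth G`, hence at least `treewidth G`, other sites; **`pairBondWeight_readSet_ncard_le_elimWidth`**
  — no site reads more than `elimWidth G`.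
* **`pairBondWeight_torus_exists_readSet_ge`** — on the torus `(ℤ/L)^d`, `d, L ≥ 2`, in EVERY order some
  site reads at least `c_d·L^{d−1}` variables (`c_d = isoConst d (1/(8d))`; GEN-14 `torus_le_elimWidth`)
  — the elimination-front volume law, in the tree so far for the free field only
  (`Scaling/AutoregressiveContextLaw`, LDLᵀ algebra), now for EVERY strictly TP₂ ferromagnetic pair
  interaction on the nearest-neighbour torus (`φ⁴`, general convex gradient potentials with strictly
  TP₂ bonds, arbitrary positive bounded one-body factors).
* **`pairBondWeight_minimax_context_eq_treewidth`** — OVER ALL GENERATION ORDERS THE SMALLEST ACHIEVABLE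
  LARGEST EXACT CONTEXT IS EXACTLY `treewidth G`: in every order some site reads `≥ treewidth G` other
  sites, and in some order (GEN-14 `exists_linearOrder_elimWidth_eq_treewidth`) every site reads
  `≤ treewidth G` — both directions with the order quantified inside the statement.

* §3 **THE ISING INSTANCE** — `expCoupling_tp2` / `expCoupling_stp2` (on any linear order `exp(J·σ(u)·σ(v))`
  is TP₂ for `σ` monotone, `J ≥ 0`, strictly TP₂ for `σ` strictly monotone, `J > 0`);
  **`ising_arConditional_reads_iff_mem_higherAdj`** — spins `x : V → Fin 2` (`σ = 2x − 1`), weight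
  `∏_i exp(h_i σ_i)·∏_e exp(J_e σ_{src e} σ_{tgt e})`, `J_e > 0` on terms joining `G`-adjacent sites, every
  edge of `G` carrying one, ARBITRARY fields, any probability measure on `Fin 2` charging both values:
  the exact conditional of the spin at `a` reads `v ≠ a` IFF `v ∈ adj⁺_{elim G}(a)`;
  **`ising_minimax_context_eq_treewidth`** — for the ferromagnetic Ising model on any graph the minimax
  exact context over generation orders is exactly `treewidth G`.

READING (value-free): exact autoregressive sampling of a non-Gaussian strictly ferromagnetic lattice
field needs, at some site, a context as large as the treewidth of the interaction graph — a full
cross-section `Θ(L^{d−1})` of the torus — whatever the generation order, and the treewidth is attained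
by the best order — for the Ising model at every temperature and field in particular (antiferromagnets on
bipartite graphs reduce to it by flipping a sublattice; not typed).  NOT CLAIMED: gauge theories;
frustrated couplings; TP₂-but-not-strict bonds; approximate (non-exact) samplers; any rate or number of
ours beyond the combinatorial constants of GEN-14.  Elementary over the
parents; nothing is cited as a fact; no `def`; no `sorry`.
-/

noncomputable section

namespace Summit.Ventures.LatticeQCDFlow.Theory2.Autoregressive

open MeasureTheory Function Set
open Summit.Ventures.LatticeQCDFlow.Exactness

variable {X : Type*} [LinearOrder X] [MeasurableSpace X]

/-! ## §1 Counting the read set -/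

section Count

open Literature.Combinatorics.SimpleGraph Literature.LinearAlgebra.Matrix.ChordalSparsity
open Literature.Probability.LatticeModels (TorusSite torusGraph)

variable {V : Type*} [Fintype V] [LinearOrder V] [DecidableEq V] (μ : Measure X)
  [IsProbabilityMeasure μ]

/-- **SOME SITE READS AT LEAST `tw(G)` VARIABLES — FOR EVERY GENERATION ORDER.**  Under the
hypotheses of `pairBondWeight_arConditional_reads_iff_mem_higherAdj` (strictly TP₂ ferromagnetic pair
interaction on `G`, nonempty vertex set) there is a site `a` whose exact conditional reads exactly
`elimWidth G` other sites, hence at least `treewidth G` of them (GEN-14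
`treewidth_le_elimWidth`): an exact autoregressive sampler cannot have all its contexts smaller than
the treewidth of the interaction graph, whatever the order. [ours] -/
theorem pairBondWeight_exists_readSet_ge_treewidth {η : Type*} [Nonempty V]
    (hμ : 0 < (μ.prod μ) {p : X × X | p.1 < p.2}) (G : SimpleGraph V) (E : Finset η)
    (src tgt : η → V) (b : η → X → X → ℝ) (g : V → X → ℝ) (hgm : ∀ i, Measurable (g i))
    (hbm : ∀ e, Measurable (uncurry (b e))) (hg0 : ∀ i u, 0 < g i u) (hb0 : ∀ e u v, 0 < b e u v)
    (hgC : ∀ i, ∃ C, ∀ u, g i u ≤ C) (hbC : ∀ e, ∃ C, ∀ u v, b e u v ≤ C)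
    (hb : ∀ e u u' v v', u ≤ u' → v ≤ v' → b e u' v * b e u v' ≤ b e u v * b e u' v')
    (hEG : ∀ e ∈ E, src e ≠ tgt e → G.Adj (src e) (tgt e))
    (hGE : ∀ i k, G.Adj i k → ∃ e ∈ E, ((src e = i ∧ tgt e = k) ∨ (src e = k ∧ tgt e = i)) ∧
        ∀ u u' v v', u < u' → v < v' → b e u' v * b e u v' < b e u v * b e u' v') :
    let w : (V → X) → ℝ := fun x => (∏ i, g i (x i)) * ∏ e ∈ E, b e (x (src e)) (x (tgt e))
    ∃ a : V, elimWidth G = {v : V | v ≠ a ∧ ∃ ψ ψ' : V → X, (∀ i, i ≠ v → ψ i = ψ' i) ∧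
        coordAvg μ (Finset.univ.filter (· < a)) w ψ /
            coordAvg μ (insert a (Finset.univ.filter (· < a))) w ψ ≠
          coordAvg μ (Finset.univ.filter (· < a)) w ψ' /
            coordAvg μ (insert a (Finset.univ.filter (· < a))) w ψ'}.ncard ∧
      treewidth G ≤ {v : V | v ≠ a ∧ ∃ ψ ψ' : V → X, (∀ i, i ≠ v → ψ i = ψ' i) ∧
        coordAvg μ (Finset.univ.filter (· < a)) w ψ /
            coordAvg μ (insert a (Finset.univ.filter (· < a))) w ψ ≠
          coordAvg μ (Finset.univ.filter (· < a)) w ψ' /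
            coordAvg μ (insert a (Finset.univ.filter (· < a))) w ψ'}.ncard := by
  intro w
  obtain ⟨a, -, ha⟩ := Finset.exists_mem_eq_sup (Finset.univ : Finset V) Finset.univ_nonempty
    fun v => (higherAdj (elimGraph G).Adj v).ncard
  have hset := pairBondWeight_readSet_eq_higherAdj μ hμ G E src tgt b g hgm hbm hg0 hb0 hgC hbC hb
    hEG hGE a
  refine ⟨a, ?_, ?_⟩
  · rw [hset]; exact ha
  · rw [hset, ← ha]; exact treewidth_le_elimWidth

/-- **… AND NO SITE READS MORE THAN `elimWidth G` OTHER SITES** (every read set is a higher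
fill-neighbourhood, GEN-14 `ncard_higherAdj_elimGraph_le_elimWidth`).  With
`exists_linearOrder_elimWidth_eq_treewidth` (an order with `elimWidth = treewidth` exists) and the
previous theorem: THE SMALLEST ACHIEVABLE LARGEST EXACT CONTEXT, OVER ALL GENERATION ORDERS, IS EXACTLY
`treewidth G`. [ours] -/
theorem pairBondWeight_readSet_ncard_le_elimWidth {η : Type*}
    (hμ : 0 < (μ.prod μ) {p : X × X | p.1 < p.2}) (G : SimpleGraph V) (E : Finset η)
    (src tgt : η → V) (b : η → X → X → ℝ) (g : V → X → ℝ) (hgm : ∀ i, Measurable (g i))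
    (hbm : ∀ e, Measurable (uncurry (b e))) (hg0 : ∀ i u, 0 < g i u) (hb0 : ∀ e u v, 0 < b e u v)
    (hgC : ∀ i, ∃ C, ∀ u, g i u ≤ C) (hbC : ∀ e, ∃ C, ∀ u v, b e u v ≤ C)
    (hb : ∀ e u u' v v', u ≤ u' → v ≤ v' → b e u' v * b e u v' ≤ b e u v * b e u' v')
    (hEG : ∀ e ∈ E, src e ≠ tgt e → G.Adj (src e) (tgt e))
    (hGE : ∀ i k, G.Adj i k → ∃ e ∈ E, ((src e = i ∧ tgt e = k) ∨ (src e = k ∧ tgt e = i)) ∧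
        ∀ u u' v v', u < u' → v < v' → b e u' v * b e u v' < b e u v * b e u' v') (a : V) :
    let w : (V → X) → ℝ := fun x => (∏ i, g i (x i)) * ∏ e ∈ E, b e (x (src e)) (x (tgt e))
    {v : V | v ≠ a ∧ ∃ ψ ψ' : V → X, (∀ i, i ≠ v → ψ i = ψ' i) ∧
        coordAvg μ (Finset.univ.filter (· < a)) w ψ /
            coordAvg μ (insert a (Finset.univ.filter (· < a))) w ψ ≠
          coordAvg μ (Finset.univ.filter (· < a)) w ψ' /
            coordAvg μ (insert a (Finset.univ.filter (· < a))) w ψ'}.ncard ≤ elimWidth G := by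
  intro w
  rw [pairBondWeight_readSet_eq_higherAdj μ hμ G E src tgt b g hgm hbm hg0 hb0 hgC hbC hb hEG hGE a]
  exact ncard_higherAdj_elimGraph_le_elimWidth a

/-- **ON THE TORUS `(ℤ/L)^d` SOME SITE READS AT LEAST `c_d·L^{d−1}` VARIABLES, IN EVERY ORDER** (GEN-14's
elimination-front volume law `torus_le_elimWidth`, now for every strictly TP₂ ferromagnetic pair
interaction on the nearest-neighbour torus graph, not only the free field of
`AutoregressiveContextLaw`): `d, L ≥ 2`, any linear order of the sites, hypotheses as above with
`G = torusGraph d L`. [ours] -/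
theorem pairBondWeight_torus_exists_readSet_ge {η : Type*} {d L : ℕ} [NeZero L]
    [LinearOrder (TorusSite d L)] (hd : 2 ≤ d) (hL : 2 ≤ L)
    (hμ : 0 < (μ.prod μ) {p : X × X | p.1 < p.2}) (E : Finset η)
    (src tgt : η → TorusSite d L) (b : η → X → X → ℝ) (g : TorusSite d L → X → ℝ)
    (hgm : ∀ i, Measurable (g i)) (hbm : ∀ e, Measurable (uncurry (b e)))
    (hg0 : ∀ i u, 0 < g i u) (hb0 : ∀ e u v, 0 < b e u v)
    (hgC : ∀ i, ∃ C, ∀ u, g i u ≤ C) (hbC : ∀ e, ∃ C, ∀ u v, b e u v ≤ C)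
    (hb : ∀ e u u' v v', u ≤ u' → v ≤ v' → b e u' v * b e u v' ≤ b e u v * b e u' v')
    (hEG : ∀ e ∈ E, src e ≠ tgt e → (torusGraph d L).Adj (src e) (tgt e))
    (hGE : ∀ i k, (torusGraph d L).Adj i k →
      ∃ e ∈ E, ((src e = i ∧ tgt e = k) ∨ (src e = k ∧ tgt e = i)) ∧
        ∀ u u' v v', u < u' → v < v' → b e u' v * b e u v' < b e u v * b e u' v') :
    let w : (TorusSite d L → X) → ℝ := fun x => (∏ i, g i (x i)) * ∏ e ∈ E, b e (x (src e)) (x (tgt e))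
    ∃ a : TorusSite d L, isoConst d (1 / (8 * d)) * (L : ℝ) ^ (d - 1) ≤
      ({v : TorusSite d L | v ≠ a ∧ ∃ ψ ψ' : TorusSite d L → X, (∀ i, i ≠ v → ψ i = ψ' i) ∧
        coordAvg μ (Finset.univ.filter (· < a)) w ψ /
            coordAvg μ (insert a (Finset.univ.filter (· < a))) w ψ ≠
          coordAvg μ (Finset.univ.filter (· < a)) w ψ' /
            coordAvg μ (insert a (Finset.univ.filter (· < a))) w ψ'}.ncard : ℝ) := by
  intro w
  haveI : Nonempty (TorusSite d L) := ⟨fun _ => 0⟩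
  obtain ⟨a, hwidth, -⟩ := pairBondWeight_exists_readSet_ge_treewidth μ hμ (torusGraph d L) E src
    tgt b g hgm hbm hg0 hb0 hgC hbC hb hEG hGE
  exact ⟨a, by rw [← hwidth]; exact torus_le_elimWidth hd hL inferInstance⟩

end Count

/-! ## §2 The minimax over generation orders -/

section MinMax

open Literature.Combinatorics.SimpleGraph Literature.LinearAlgebra.Matrix.ChordalSparsity

/-- **OVER ALL GENERATION ORDERS, THE SMALLEST ACHIEVABLE LARGEST EXACT CONTEXT IS EXACTLY THE
TREEWIDTH OF THE INTERACTION GRAPH.**  For a strictly TP₂ ferromagnetic pair interaction on `G`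
(hypotheses of `pairBondWeight_arConditional_reads_iff_mem_higherAdj`): (i) in EVERY linear order of the
sites some site's exact conditional reads at least `treewidth G` other sites; (ii) in SOME linear order
every site's exact conditional reads at most `treewidth G` other sites (GEN-14
`exists_linearOrder_elimWidth_eq_treewidth`). [ours] -/
theorem pairBondWeight_minimax_context_eq_treewidth {η V : Type*} [Fintype V] [DecidableEq V]
    [Nonempty V] (μ : Measure X) [IsProbabilityMeasure μ]
    (hμ : 0 < (μ.prod μ) {p : X × X | p.1 < p.2}) (G : SimpleGraph V) (E : Finset η)
    (src tgt : η → V) (b : η → X → X → ℝ) (g : V → X → ℝ) (hgm : ∀ i, Measurable (g i))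
    (hbm : ∀ e, Measurable (uncurry (b e))) (hg0 : ∀ i u, 0 < g i u) (hb0 : ∀ e u v, 0 < b e u v)
    (hgC : ∀ i, ∃ C, ∀ u, g i u ≤ C) (hbC : ∀ e, ∃ C, ∀ u v, b e u v ≤ C)
    (hb : ∀ e u u' v v', u ≤ u' → v ≤ v' → b e u' v * b e u v' ≤ b e u v * b e u' v')
    (hEG : ∀ e ∈ E, src e ≠ tgt e → G.Adj (src e) (tgt e))
    (hGE : ∀ i k, G.Adj i k → ∃ e ∈ E, ((src e = i ∧ tgt e = k) ∨ (src e = k ∧ tgt e = i)) ∧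
        ∀ u u' v v', u < u' → v < v' → b e u' v * b e u v' < b e u v * b e u' v') :
    let w : (V → X) → ℝ := fun x => (∏ i, g i (x i)) * ∏ e ∈ E, b e (x (src e)) (x (tgt e))
    (∀ o : LinearOrder V, letI := o
      ∃ a : V, treewidth G ≤ {v : V | v ≠ a ∧ ∃ ψ ψ' : V → X, (∀ i, i ≠ v → ψ i = ψ' i) ∧
        coordAvg μ (Finset.univ.filter (· < a)) w ψ /
            coordAvg μ (insert a (Finset.univ.filter (· < a))) w ψ ≠
          coordAvg μ (Finset.univ.filter (· < a)) w ψ' /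
            coordAvg μ (insert a (Finset.univ.filter (· < a))) w ψ'}.ncard) ∧
    (∃ o : LinearOrder V, letI := o
      ∀ a : V, {v : V | v ≠ a ∧ ∃ ψ ψ' : V → X, (∀ i, i ≠ v → ψ i = ψ' i) ∧
        coordAvg μ (Finset.univ.filter (· < a)) w ψ /
            coordAvg μ (insert a (Finset.univ.filter (· < a))) w ψ ≠
          coordAvg μ (Finset.univ.filter (· < a)) w ψ' /
            coordAvg μ (insert a (Finset.univ.filter (· < a))) w ψ'}.ncard ≤ treewidth G) := by
  intro w
  refine ⟨fun o => ?_, ?_⟩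
  · letI : LinearOrder V := o
    obtain ⟨a, -, h⟩ := pairBondWeight_exists_readSet_ge_treewidth μ hμ G E src tgt b g hgm hbm hg0
      hb0 hgC hbC hb hEG hGE
    exact ⟨a, h⟩
  · obtain ⟨o, ho⟩ := exists_linearOrder_elimWidth_eq_treewidth G
    refine ⟨o, ?_⟩
    letI : LinearOrder V := o
    intro a
    rw [← ho]
    exact pairBondWeight_readSet_ncard_le_elimWidth μ hμ G E src tgt b g hgm hbm hg0 hb0 hgC hbC hb
      hEG hGE a

end MinMax

/-! ## §3 The Ising instance: exponential couplings on two-point spins -/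

section Ising

open Literature.Combinatorics.SimpleGraph Literature.LinearAlgebra.Matrix.ChordalSparsity

omit [MeasurableSpace X] in
/-- **An exponential coupling `exp(J·σ(u)·σ(v))` with `σ` monotone and `J ≥ 0` is TP₂** (the minor's
log is `J(σ u' − σ u)(σ v' − σ v) ≥ 0`). [ours] -/
theorem expCoupling_tp2 (σ : X → ℝ) (hσ : Monotone σ) {J : ℝ} (hJ : 0 ≤ J) (u u' v v' : X)
    (hu : u ≤ u') (hv : v ≤ v') :
    Real.exp (J * σ u' * σ v) * Real.exp (J * σ u * σ v') ≤
      Real.exp (J * σ u * σ v) * Real.exp (J * σ u' * σ v') := by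
  rw [← Real.exp_add, ← Real.exp_add, Real.exp_le_exp]
  have : 0 ≤ J * ((σ u' - σ u) * (σ v' - σ v)) :=
    mul_nonneg hJ (mul_nonneg (sub_nonneg.2 (hσ hu)) (sub_nonneg.2 (hσ hv)))
  nlinarith [this]

omit [MeasurableSpace X] in
/-- **… and STRICTLY TP₂ when `σ` is strictly monotone and `J > 0`.** [ours] -/
theorem expCoupling_stp2 (σ : X → ℝ) (hσ : StrictMono σ) {J : ℝ} (hJ : 0 < J) (u u' v v' : X)
    (hu : u < u') (hv : v < v') :
    Real.exp (J * σ u' * σ v) * Real.exp (J * σ u * σ v') <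
      Real.exp (J * σ u * σ v) * Real.exp (J * σ u' * σ v') := by
  rw [← Real.exp_add, ← Real.exp_add, Real.exp_lt_exp]
  have : 0 < J * ((σ u' - σ u) * (σ v' - σ v)) :=
    mul_pos hJ (mul_pos (sub_pos.2 (hσ hu)) (sub_pos.2 (hσ hv)))
  nlinarith [this]

variable {V : Type*} [Fintype V] [LinearOrder V] [DecidableEq V]

/-- **THE FERROMAGNETIC ISING MODEL ON ANY GRAPH: THE CONTEXT OF THE EXACT AUTOREGRESSIVE CONDITIONAL OF
A SPIN IS EXACTLY ITS FILL-NEIGHBOURHOOD.**  Spins `x : V → Fin 2` (`σ = 2x − 1 ∈ {−1, +1}`), weight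
`w(x) = ∏_i exp(h_i σ_i) · ∏_{e∈E} exp(J_e σ_{src e} σ_{tgt e})` with couplings `J_e > 0` on terms joining
`G`-adjacent sites, every edge of `G` carrying one, ARBITRARY fields `h_i`; reference measure any
probability measure on `Fin 2` charging both spins values (e.g. the uniform one); generation from the
top.  Then for every `v ≠ a` the exact conditional `A_s w / A_{insert a s} w` of the spin at `a` reads
`v` iff `v ∈ adj⁺_{elim G}(a)`. [ours] -/
theorem ising_arConditional_reads_iff_mem_higherAdj {η : Type*} (μ : Measure (Fin 2))
    [IsProbabilityMeasure μ] (hμ0 : μ {0} ≠ 0) (hμ1 : μ {1} ≠ 0) (G : SimpleGraph V) (E : Finset η)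
    (src tgt : η → V) (J : η → ℝ) (hJ : ∀ e, 0 < J e) (h : V → ℝ)
    (hEG : ∀ e ∈ E, src e ≠ tgt e → G.Adj (src e) (tgt e))
    (hGE : ∀ i k, G.Adj i k → ∃ e ∈ E, (src e = i ∧ tgt e = k) ∨ (src e = k ∧ tgt e = i))
    (a : V) {v : V} (hva : v ≠ a) :
    let σ : Fin 2 → ℝ := fun u => 2 * (u : ℝ) - 1
    let w : (V → Fin 2) → ℝ := fun x =>
      (∏ i, Real.exp (h i * σ (x i))) * ∏ e ∈ E, Real.exp (J e * σ (x (src e)) * σ (x (tgt e)))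
    (∃ ψ ψ' : V → Fin 2, (∀ i, i ≠ v → ψ i = ψ' i) ∧
      coordAvg μ (Finset.univ.filter (· < a)) w ψ /
          coordAvg μ (insert a (Finset.univ.filter (· < a))) w ψ ≠
        coordAvg μ (Finset.univ.filter (· < a)) w ψ' /
          coordAvg μ (insert a (Finset.univ.filter (· < a))) w ψ') ↔
      v ∈ higherAdj (elimGraph G).Adj a := by
  intro σ w
  have hσ : StrictMono σ := fun u u' huu' => by
    simp only [σ]
    have : (u : ℝ) < (u' : ℝ) := by exact_mod_cast huu'
    linarith
  have hμ : 0 < (μ.prod μ) {p : Fin 2 × Fin 2 | p.1 < p.2} := by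
    have hsub : ({0} : Set (Fin 2)) ×ˢ ({1} : Set (Fin 2)) ⊆ {p : Fin 2 × Fin 2 | p.1 < p.2} := by
      rintro ⟨p1, p2⟩ ⟨h1, h2⟩
      simp only [Set.mem_singleton_iff] at h1 h2
      subst h1; subst h2
      show (0 : Fin 2) < 1
      decide
    refine lt_of_lt_of_le ?_ (measure_mono hsub)
    rw [Measure.prod_prod]
    exact ENNReal.mul_pos hμ0 hμ1
  exact pairBondWeight_arConditional_reads_iff_mem_higherAdj μ hμ G E src tgt
    (fun e u x => Real.exp (J e * σ u * σ x)) (fun i u => Real.exp (h i * σ u))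
    (fun i => measurable_of_countable _) (fun e => measurable_of_countable _)
    (fun i u => Real.exp_pos _) (fun e u x => Real.exp_pos _)
    (fun i => by
      obtain ⟨u₀, hu₀⟩ := Finite.exists_max fun u : Fin 2 => Real.exp (h i * σ u)
      exact ⟨_, hu₀⟩)
    (fun e => by
      obtain ⟨p₀, hp₀⟩ := Finite.exists_max fun p : Fin 2 × Fin 2 => Real.exp (J e * σ p.1 * σ p.2)
      exact ⟨_, fun u x => hp₀ (u, x)⟩)
    (fun e u u' x y hu hxy => expCoupling_tp2 σ hσ.monotone (hJ e).le u u' x y hu hxy) hEG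
    (fun i k hik => (hGE i k hik).imp fun e he => ⟨he.1, he.2, fun u u' x y hu hxy =>
      expCoupling_stp2 σ hσ (hJ e) u u' x y hu hxy⟩) a hva

end Ising

section IsingMinMax

open Literature.Combinatorics.SimpleGraph Literature.LinearAlgebra.Matrix.ChordalSparsity

/-- **FOR THE FERROMAGNETIC ISING MODEL ON ANY GRAPH, OVER ALL GENERATION ORDERS THE SMALLEST ACHIEVABLE
LARGEST EXACT CONTEXT IS EXACTLY THE TREEWIDTH OF THE INTERACTION GRAPH** (couplings `J_e > 0`,
arbitrary fields, any reference measure on `Fin 2` charging both spin values): in every order some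
spin's exact conditional reads `≥ treewidth G` other spins, in some order every spin reads
`≤ treewidth G`. [ours] -/
theorem ising_minimax_context_eq_treewidth {η V : Type*} [Fintype V] [DecidableEq V] [Nonempty V]
    (μ : Measure (Fin 2)) [IsProbabilityMeasure μ] (hμ0 : μ {0} ≠ 0) (hμ1 : μ {1} ≠ 0)
    (G : SimpleGraph V) (E : Finset η) (src tgt : η → V) (J : η → ℝ) (hJ : ∀ e, 0 < J e)
    (h : V → ℝ) (hEG : ∀ e ∈ E, src e ≠ tgt e → G.Adj (src e) (tgt e))
    (hGE : ∀ i k, G.Adj i k → ∃ e ∈ E, (src e = i ∧ tgt e = k) ∨ (src e = k ∧ tgt e = i)) :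
    let σ : Fin 2 → ℝ := fun u => 2 * (u : ℝ) - 1
    let w : (V → Fin 2) → ℝ := fun x =>
      (∏ i, Real.exp (h i * σ (x i))) * ∏ e ∈ E, Real.exp (J e * σ (x (src e)) * σ (x (tgt e)))
    (∀ o : LinearOrder V, letI := o
      ∃ a : V, treewidth G ≤ {v : V | v ≠ a ∧ ∃ ψ ψ' : V → Fin 2, (∀ i, i ≠ v → ψ i = ψ' i) ∧
        coordAvg μ (Finset.univ.filter (· < a)) w ψ /
            coordAvg μ (insert a (Finset.univ.filter (· < a))) w ψ ≠
          coordAvg μ (Finset.univ.filter (· < a)) w ψ' /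
            coordAvg μ (insert a (Finset.univ.filter (· < a))) w ψ'}.ncard) ∧
    (∃ o : LinearOrder V, letI := o
      ∀ a : V, {v : V | v ≠ a ∧ ∃ ψ ψ' : V → Fin 2, (∀ i, i ≠ v → ψ i = ψ' i) ∧
        coordAvg μ (Finset.univ.filter (· < a)) w ψ /
            coordAvg μ (insert a (Finset.univ.filter (· < a))) w ψ ≠
          coordAvg μ (Finset.univ.filter (· < a)) w ψ' /
            coordAvg μ (insert a (Finset.univ.filter (· < a))) w ψ'}.ncard ≤ treewidth G) := by
  intro σ w
  have hσ : StrictMono σ := fun u u' huu' => by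
    simp only [σ]
    have : (u : ℝ) < (u' : ℝ) := by exact_mod_cast huu'
    linarith
  have hμ : 0 < (μ.prod μ) {p : Fin 2 × Fin 2 | p.1 < p.2} := by
    have hsub : ({0} : Set (Fin 2)) ×ˢ ({1} : Set (Fin 2)) ⊆ {p : Fin 2 × Fin 2 | p.1 < p.2} := by
      rintro ⟨p1, p2⟩ ⟨h1, h2⟩
      simp only [Set.mem_singleton_iff] at h1 h2
      subst h1; subst h2
      show (0 : Fin 2) < 1
      decide
    refine lt_of_lt_of_le ?_ (measure_mono hsub)
    rw [Measure.prod_prod]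
    exact ENNReal.mul_pos hμ0 hμ1
  exact pairBondWeight_minimax_context_eq_treewidth μ hμ G E src tgt
    (fun e u x => Real.exp (J e * σ u * σ x)) (fun i u => Real.exp (h i * σ u))
    (fun i => measurable_of_countable _) (fun e => measurable_of_countable _)
    (fun i u => Real.exp_pos _) (fun e u x => Real.exp_pos _)
    (fun i => by
      obtain ⟨u₀, hu₀⟩ := Finite.exists_max fun u : Fin 2 => Real.exp (h i * σ u)
      exact ⟨_, hu₀⟩)
    (fun e => by
      obtain ⟨p₀, hp₀⟩ := Finite.exists_max fun p : Fin 2 × Fin 2 => Real.exp (J e * σ p.1 * σ p.2)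
      exact ⟨_, fun u x => hp₀ (u, x)⟩)
    (fun e u u' x y hu hxy => expCoupling_tp2 σ hσ.monotone (hJ e).le u u' x y hu hxy) hEG
    (fun i k hik => (hGE i k hik).imp fun e he => ⟨he.1, he.2, fun u u' x y hu hxy =>
      expCoupling_stp2 σ hσ (hJ e) u u' x y hu hxy⟩)

end IsingMinMax

end Summit.Ventures.LatticeQCDFlow.Theory2.Autoregressive

end
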